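import Summits.ABC.IUTFork.Repair.RHSigmaCellCreditAbcExp
import Summits.ABC.IUTFork.Repair.RHSigmaMassGap
import HarnessLib

/-!
# D-0121 (1)(b) T-OPTIMALITY, the GLUE (sequel 2): the WITHIN-PLACE financed door in CLOSED FORM — «per-packet financing paid by that packet's own (signed)
# on-σ charge ⟹ Cor. 3.12 up to `B_triv(σᶜ) − (financed mass)`», NO licence binder —, the LIC/net-WITHIN corner of rh-lead g3's R29 grid (the netting number of record, R30 (2))

PROOF-ONLY sequel (0 definitions, 0 `Prop` facts, no instance, no notation; nothing re-typed; imports q2-eq p486022 + w-1 p478601 only) of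
`Conditional/AbcExpOfSigmaMassFinanced.lean` (p489258) and `…FinancedCone.lean` (p491138) — abc-iut cell, rung LADDER-ABC:A2.RESCUE.H, seat abc-iut-topt-pv-3
(D-0121 (1)(b) prover 3/3). R29 (02:42:43Z) grid: information ∈ {LIC, EX} × netting ∈ {none, WITHIN-place, ACROSS-places}; R30 (2): «the within-place tier is the
honest netting number of record» (across-places credit sits at non-binding wild places and is charged on the cone side, p491138). The prequel gave the
ACROSS-places corner a closed form WITHOUT weights (`statementUpTo_onCharge_add_offTrivialMass`: `T′ = T − C_σ`). This file gives the WITHIN-place corner the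
same treatment: the scheme is the EXPLICIT weight `ω = 1_σ + φ` (`φ ≥ 0` the financing, `1_σ + φ ≤ 1`), and the weighted door's aggregate hypothesis
«`weightedDeficit ω ≤ 0`» (p480491) is DISCHARGED from ONE inequality per packet `v_ℚ`: «the financed trivial mass of the packet, `Σ_i φ(i,v_ℚ)·t(i,v_ℚ)`, is at
most the packet's own signed on-σ charge `Σ_i 1_σ(i,v_ℚ)·(−d(i,v_ℚ))`» (= its licensed surplus `C_{v_ℚ}` when `σ` is licensed) — no credit crosses packets, and,
as for the across-places door of the prequel, NO licence hypothesis is needed. The resulting tolerance is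
`B_triv(σᶜ) − PN Σᶠ φ·t` (closed form `T′_within = T − Σ_{v_ℚ} min(C_{v_ℚ}, Debt_{v_ℚ})` at the optimal `φ`, abc-iut-topt-pv-2 p490154 `exists_kept_eq_min` packet
by packet: value forced, scheme free on ties — the uniform `φ = θ_{v_ℚ}·1` on the packet's deficit cells, `θ = min(1, C/Debt)`, is one optimal choice).

COMPOSED BY NAME from: q2-eq p480491 (`weightedDeficit`, `weightedTrivialMass`, `cellDeficit_le_cellTrivialCost`, `weightedDeficit_support_finite`,
`weightedTrivialMass_support_finite`, THE WEIGHTED DOOR `statementUpTo_weightedTrivialMass_of_weightedDeficit_nonpos`), p479556 (`cellDeficit_support_finite`,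
`cellDeficit_nonpos_of_licenceOn`), rh2-T-1 p477034 (`offTrivialMass`, `cellTrivialCost_support_finite`), q2-eq's adapter p484564 (`cor312UpTo_of_statementUpTo_chosen`),
Mathlib `sum_finsum_comm` (label sum ↔ packet sum, as in w-1 p477616 `mass_labelSegment_eq`).

WHAT IS TYPED (generic: ANY `P : Cor312.Setting S` under the bridge hypotheses; `1_σ` the indicator weight; `φ : cells → ℝ`):
* §1 `weightedTrivialMass_indicator_add` — `weightedTrivialMass P (1_σ + φ) = offTrivialMass P σ − PN Σᶠ φ·t` (the financed mass comes off `B_triv(σᶜ)`; no hypothesis).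
* §1 **`weightedDeficit_indicator_add_nonpos_of_packetFinanced`** — for EVERY `σ` (NO licence binder) and `φ ≥ 0`: [FIN-within] «∀ v_ℚ, `Σ_i φ(i,v_ℚ)·t(i,v_ℚ) ≤
  Σ_i 1_σ(i,v_ℚ)·(−d(i,v_ℚ))`» (right side = the packet's surplus `C_{v_ℚ}(σ) ≥ 0` when `σ` is licensed) ⟹ `weightedDeficit P (1_σ + φ) ≤ 0`: THE WEIGHTED DOOR's [W]
  DISCHARGED packet by packet (cellwise `(1_σ+φ)·d ≤ 1_σ·d + φ·t`, then `sum_finsum_comm` and the per-packet inequality).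
* §1 **`statementUpTo_withinFinanced`** — THE WITHIN-PLACE FINANCED DOOR: [FIN-within], `φ ≥ 0`, `1_σ + φ ≤ 1` ⟹ `StatementUpTo P (offTrivialMass P σ − PN Σᶠ φ·t)` —
  «each packet's top cells financed by that packet's own on-σ charge ⟹ Cor. 3.12 up to `B_triv(σᶜ)` MINUS the financed mass» (LIC/net-within, `T′_a` of the lp
  tables), the licence being needed only to READ the right side of [FIN-within] as a surplus; `offTrivialMass_sub_financed_le_offTrivialMass`: `≤` the licence-only tolerance.
* §2 AT THE DATUM (chosen realising ideles): **`cor312UpTo_withinFinanced_chosen`** — the same ⟹ `T.negAbsLogQ ≤ T.negLogTheta + (B_triv(σᶜ) − PN Σᶠ φ·t)`,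
  i.e. abc-iut-rh2-q2-cond's [NUMΣ-C] binder with `ε := B_triv(σᶜ) − financed`, so the EXP end is `Conditional.Cor312Slack.ABCExpOn_farFromCusps_of_cor312Slack_mu_content_hregC_degOne`
  (p484796) BY NAME, equivalently the prequel's `abcExpOn_farFromCusps_of_weightedDeficit_nonpos_mu_content_hregC` at `ω := 1_σ + φ` with [W-C] discharged by §1;
  its cone charge is p491138 `keptMass_le_of_weightedDeficit_nonpos_of_hullEstimateOf_chosen` (kept `= mass(σ) + financed ≤ δ + arch`).
HONEST FRAMING: implications about OUR typed objects; [FIN-within] is an ASSUMPTION SHAPE (a statement about the candidate financing `φ` against DEFINED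
datum numbers), never asserted for any datum; what the within-place tier achieves on the bed is the LP seats' certified table (topt-lp-1 / topt-lp-2,
A≡B; FREY133 kept fraction 0.524 → 0.629 at LIC information, run 3), computed ≠ proved; nothing here asserts that abc (with any exponent) is proved or refuted, or
that [IUTchIII] Cor. 3.12 / [IUTchIV] Thm. 1.10 holds or fails at any datum, or takes a side on any author (Mochizuki / Scholze–Stix / Joshi / Dupuy–Hilado);
typed ≠ proved; instantiated ≠ endorsed. [claim: Mochizuki2012, status: disputed] for every IUT locution.
[cite: Mochizuki2012, IUTchIII Cor. 3.12 p. 173–174, Prop. 3.9 (i)(iii) p. 116; IUTchIV Thm. 1.10 pp. 22–31] [cite: DupuyHilado2025, §3.9]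
-/

noncomputable section

open Set Function NumberField IsDedekindDomain

namespace Summit.ABC.IUTFork.Conditional.SigmaMass

open Summit.ABC.IUTFork.Thm311 Summit.ABC.IUTFork.Thm311.Real Summit.ABC.IUTFork.Cor312 Summit.ABC.IUTFork.Cor312.Setting
  Summit.ABC.IUTFork.Cor312Vol Summit.ABC.IUTFork.Cor312Prov Literature.IUT.LogThetaLattice Literature.IUT.LogVolume
  Literature.IUT.HodgeTheaters Literature.IUT.LogVolume.ThetaData
  Literature.NumberTheory.DiophantineGeometry Literature.NumberTheory.DiophantineGeometry.GenEll Summit.ABC.ABC.Theorems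
  Summit.ABC.IUTFork.Repair.RH.SigmaLicence Summit.ABC.IUTFork.Repair.RH.SigmaStrataEq Summit.ABC.IUTFork.Repair.RH.SigmaMass
  Summit.ABC.IUTFork.Repair.RH.OffSigma Summit.ABC.IUTFork.Repair.RH.CellWeights Summit.ABC.IUTFork.Conditional

/-! ## §1. Generic: the within-place financed door -/

section Generic

variable {ι : ThetaIndex} {S : Situation ι} {P : Cor312.Setting S}

/-- Per label, `φ·t` is finitely supported over `v_ℚ` (inside the support of the trivial cost). [folklore] -/
theorem mul_cellTrivialCost_support_finite (H : BridgeHyps P) (φ : Fin ι.lstar × ι.VQ → ℝ) (i : Fin ι.lstar) :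
    (Function.support fun vQ : ι.VQ => φ (i, vQ) * cellTrivialCost P (i, vQ)).Finite :=
  (cellTrivialCost_support_finite H i).subset fun vQ hv => by
    rw [Function.mem_support] at hv ⊢
    exact fun h0 => hv (by rw [h0, mul_zero])

/-- Per label, `1_σ·d` is finitely supported over `v_ℚ` (inside the support of the deficit). [folklore] -/
theorem indicator_cellDeficit_support_finite (H : BridgeHyps P) (σ : Set (Fin ι.lstar × ι.VQ)) (i : Fin ι.lstar) :
    (Function.support fun vQ : ι.VQ => σ.indicator (fun c : Fin ι.lstar × ι.VQ => cellDeficit P c.1 c.2) (i, vQ)).Finite :=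
  (cellDeficit_support_finite H i).subset fun vQ hv => by
    rw [Function.mem_support] at hv ⊢
    exact fun h0 => hv (Set.indicator_apply_eq_zero.2 fun _ => h0)

/-- **The financed mass comes off `B_triv(σᶜ)`**: `weightedTrivialMass P (1_σ + φ) = offTrivialMass P σ − PN Σᶠ φ·t` (cell by cell
`(1 − 1_σ − φ)·t = 1_{σᶜ}·t − φ·t`; no hypothesis on `φ`). [folklore] -/
theorem weightedTrivialMass_indicator_add (H : BridgeHyps P) (σ : Set (Fin ι.lstar × ι.VQ)) (φ : Fin ι.lstar × ι.VQ → ℝ) :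
    weightedTrivialMass P (fun c => σ.indicator (fun _ => (1 : ℝ)) c + φ c) =
      offTrivialMass P σ - processionNormalized fun i : Fin ι.lstar => ∑ᶠ vQ : ι.VQ, φ (i, vQ) * cellTrivialCost P (i, vQ) := by
  unfold weightedTrivialMass offTrivialMass processionNormalized
  rw [← sub_div, ← Finset.sum_sub_distrib]
  congr 1
  refine Finset.sum_congr rfl fun i _ => ?_
  rw [← finsum_sub_distrib (indicator_cellTrivialCost_support_finite H σᶜ i) (mul_cellTrivialCost_support_finite H φ i)]
  refine finsum_congr fun vQ => ?_
  dsimp only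
  by_cases hc : (i, vQ) ∈ σ
  · rw [Set.indicator_of_mem hc, Set.indicator_of_notMem (Set.notMem_compl_iff.mpr hc)]; ring
  · rw [Set.indicator_of_notMem hc, Set.indicator_of_mem (Set.mem_compl hc)]; ring

/-- **[W] DISCHARGED PACKET BY PACKET — NO licence binder.** Under the bridge hypotheses, for EVERY stratum `σ` and financing `φ ≥ 0`: [FIN-within] «at every
packet `v_ℚ` the financed trivial mass is paid by that packet's own SIGNED on-σ charge: `Σ_i φ(i,v_ℚ)·t(i,v_ℚ) ≤ Σ_i 1_σ(i,v_ℚ)·(−d(i,v_ℚ))`» (under the licence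
on `σ` the right side is the packet's surplus `C_{v_ℚ}(σ) ≥ 0`, p479556 `cellDeficit_nonpos_of_licenceOn`; without it the hypothesis is merely harder) gives
`weightedDeficit P (1_σ + φ) ≤ 0` — the weighted door's aggregate hypothesis for the EXPLICIT within-place scheme `ω = 1_σ + φ`. Cellwise `(1_σ + φ)·d ≤
1_σ·d + φ·t` (honest cone `d ≤ t`, p480491); label sum and packet sum exchanged (`sum_finsum_comm`); each packet nets to `≤ 0`; no credit crosses packets.
[FIN-within] is an assumption shape about `φ` against DEFINED numbers. [claim: Mochizuki2012, status: disputed] -/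
theorem weightedDeficit_indicator_add_nonpos_of_packetFinanced (H : BridgeHyps P) (σ : Set (Fin ι.lstar × ι.VQ))
    {φ : Fin ι.lstar × ι.VQ → ℝ} (hφ0 : ∀ c, 0 ≤ φ c)
    (hfin : ∀ vQ : ι.VQ, ∑ i : Fin ι.lstar, φ (i, vQ) * cellTrivialCost P (i, vQ) ≤
      ∑ i : Fin ι.lstar, -σ.indicator (fun c : Fin ι.lstar × ι.VQ => cellDeficit P c.1 c.2) (i, vQ)) :
    weightedDeficit P (fun c => σ.indicator (fun _ => (1 : ℝ)) c + φ c) ≤ 0 := by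
  -- the comparison weight `g = 1_σ·d + φ·t`, packet-summable
  set g : Fin ι.lstar → ι.VQ → ℝ := fun i vQ =>
    σ.indicator (fun c : Fin ι.lstar × ι.VQ => cellDeficit P c.1 c.2) (i, vQ) + φ (i, vQ) * cellTrivialCost P (i, vQ) with hg
  have hgfin : ∀ i : Fin ι.lstar, (Function.support (g i)).Finite := fun i =>
    ((indicator_cellDeficit_support_finite H σ i).union (mul_cellTrivialCost_support_finite H φ i)).subset
      (Function.support_add _ _)
  -- cellwise: (1_σ + φ)·d ≤ g
  have hcell : ∀ (i : Fin ι.lstar) (vQ : ι.VQ),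
      (σ.indicator (fun _ => (1 : ℝ)) (i, vQ) + φ (i, vQ)) * cellDeficit P i vQ ≤ g i vQ := by
    intro i vQ
    rw [hg, add_mul]
    refine add_le_add ?_ (mul_le_mul_of_nonneg_left (cellDeficit_le_cellTrivialCost H (i, vQ)) (hφ0 (i, vQ)))
    by_cases hc : (i, vQ) ∈ σ
    · rw [Set.indicator_of_mem hc, Set.indicator_of_mem hc, one_mul]
    · rw [Set.indicator_of_notMem hc, Set.indicator_of_notMem hc, zero_mul]
  -- label sums dominated, then exchanged with the packet sum
  have hle : ∑ i : Fin ι.lstar, ∑ᶠ vQ : ι.VQ, (σ.indicator (fun _ => (1 : ℝ)) (i, vQ) + φ (i, vQ)) * cellDeficit P i vQ ≤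
      ∑ i : Fin ι.lstar, ∑ᶠ vQ : ι.VQ, g i vQ :=
    Finset.sum_le_sum fun i _ =>
      finsum_le_finsum' (weightedDeficit_support_finite H (fun c => σ.indicator (fun _ => (1 : ℝ)) c + φ c) i) (hgfin i)
        fun vQ => hcell i vQ
  have hswap : ∑ i : Fin ι.lstar, ∑ᶠ vQ : ι.VQ, g i vQ = ∑ᶠ vQ : ι.VQ, ∑ i : Fin ι.lstar, g i vQ :=
    sum_finsum_comm Finset.univ g fun i _ => hgfin i
  have hpacket : ∀ vQ : ι.VQ, ∑ i : Fin ι.lstar, g i vQ ≤ 0 := by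
    intro vQ
    have h := hfin vQ
    rw [hg]
    simp only [Finset.sum_add_distrib]
    rw [Finset.sum_neg_distrib] at h
    linarith
  have hnonpos : ∑ᶠ vQ : ι.VQ, ∑ i : Fin ι.lstar, g i vQ ≤ 0 := by
    have h := finsum_nonneg (f := fun vQ : ι.VQ => -∑ i : Fin ι.lstar, g i vQ) fun vQ => neg_nonneg.mpr (hpacket vQ)
    rw [finsum_neg_distrib] at h
    exact neg_nonneg.mp h
  unfold weightedDeficit processionNormalized
  refine div_nonpos_iff.mpr (Or.inr ⟨?_, Nat.cast_nonneg _⟩)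
  exact hle.trans (hswap.le.trans hnonpos)

/-- **THE WITHIN-PLACE FINANCED DOOR (LIC/net-within, rh-lead R29/R30 (2)) — NO licence binder.** Under the bridge hypotheses, for EVERY stratum `σ`: a
financing `φ ≥ 0` with `1_σ + φ ≤ 1` cellwise and [FIN-within] (each packet's financed mass paid by its own signed on-σ charge) give
**`StatementUpTo P (offTrivialMass P σ − PN Σᶠ φ·t)`** — Cor. 3.12 up to `B_triv(σᶜ)` MINUS the financed mass: THE WEIGHTED DOOR (p480491) at the explicit
scheme `ω = 1_σ + φ`, [W] by `weightedDeficit_indicator_add_nonpos_of_packetFinanced`, tolerance by `weightedTrivialMass_indicator_add`; the licence on `σ` is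
NOT needed (it only makes [FIN-within]'s right side a genuine surplus) — exactly as the across-places door of the prequel needs none. At the
optimal `φ` this is `T′_within = T − Σ_{v_ℚ} min(C_{v_ℚ}, Debt_{v_ℚ})` (pv-2 p490154 packet by packet). «follows AS TYPED»; no side taken.
[cite: Mochizuki2012, IUTchIII Cor. 3.12 p. 173–174] [claim: Mochizuki2012, status: disputed] -/
theorem statementUpTo_withinFinanced (H : BridgeHyps P) (σ : Set (Fin ι.lstar × ι.VQ))
    {φ : Fin ι.lstar × ι.VQ → ℝ} (hφ0 : ∀ c, 0 ≤ φ c) (hφ1 : ∀ c, σ.indicator (fun _ => (1 : ℝ)) c + φ c ≤ 1)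
    (hfin : ∀ vQ : ι.VQ, ∑ i : Fin ι.lstar, φ (i, vQ) * cellTrivialCost P (i, vQ) ≤
      ∑ i : Fin ι.lstar, -σ.indicator (fun c : Fin ι.lstar × ι.VQ => cellDeficit P c.1 c.2) (i, vQ)) :
    StatementUpTo P (offTrivialMass P σ -
      processionNormalized fun i : Fin ι.lstar => ∑ᶠ vQ : ι.VQ, φ (i, vQ) * cellTrivialCost P (i, vQ)) := by
  rw [← weightedTrivialMass_indicator_add H σ φ]
  exact statementUpTo_weightedTrivialMass_of_weightedDeficit_nonpos H hφ1
    (weightedDeficit_indicator_add_nonpos_of_packetFinanced H σ hφ0 hfin)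

/-- The within-place financed tolerance is at most the licence-only one (`φ·t ≥ 0`): LIC/net-within ≤ LIC/none. [folklore] -/
theorem offTrivialMass_sub_financed_le_offTrivialMass {σ : Set (Fin ι.lstar × ι.VQ)} {φ : Fin ι.lstar × ι.VQ → ℝ} (hφ0 : ∀ c, 0 ≤ φ c) :
    offTrivialMass P σ - processionNormalized (fun i : Fin ι.lstar => ∑ᶠ vQ : ι.VQ, φ (i, vQ) * cellTrivialCost P (i, vQ)) ≤
      offTrivialMass P σ := by
  have h : 0 ≤ processionNormalized (fun i : Fin ι.lstar => ∑ᶠ vQ : ι.VQ, φ (i, vQ) * cellTrivialCost P (i, vQ)) :=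
    processionNormalized_nonneg fun _ => finsum_nonneg fun vQ => mul_nonneg (hφ0 _) (cellTrivialCost_nonneg _)
  linarith

end Generic

/-! ## §2. At the datum (chosen realising ideles): the [NUMΣ-C] binder of the EXP ends with `ε := B_triv(σᶜ) − financed` -/

/-- **THE WITHIN-PLACE FINANCED DOOR AT THE DATUM — NO licence binder.** At the chosen bed of a genuine Θ-volume datum `T`, for every stratum `σ` and
financing `φ`: `φ ≥ 0`, `1_σ + φ ≤ 1`, and [FIN-within] (every packet's financed trivial mass `≤` its own signed on-σ charge for OUR typed hull) give
`T.negAbsLogQ ≤ T.negLogTheta + (B_triv(σᶜ) − PN Σᶠ φ·t)` — abc-iut-rh2-q2-cond's [NUMΣ-C] binder with `ε :=` the within-place financed tolerance, so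
`Conditional.Cor312Slack.ABCExpOn_farFromCusps_of_cor312Slack_mu_content_hregC_degOne` (p484796) carries it to `ABCWithExponentOn {far from cusps} (1/μ₀)`
under [MU] «kept = mass(σ) + financed ≥ μ₀·T.gap − Tol» and [CONE-C]; cone charge p491138. «holds AS TYPED»; no side taken.
[cite: Mochizuki2012, IUTchIII Cor. 3.12 p. 173–174] [claim: Mochizuki2012, status: disputed] -/
theorem cor312UpTo_withinFinanced_chosen {P : NFPoint} {l : ℕ} (T : Cor22.ThetaVolumeDatumAt P l) :
    letI := T.instFieldF; letI := T.instNumberFieldF; letI := T.instAlgebraF; letI := T.instFieldK;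
        letI := T.instNumberFieldK; letI := T.instAlgebraK; letI := T.instFieldFbar; letI := T.instAlgebraFbar;
        letI := T.instAlgebraKFbar; letI := T.instIsElliptic;
    ∀ (M : Type) [Field M] [NumberField M]
      (archPk : ∀ (j : (thetaIndex (pilotDataOfK T.D T.K)).Label) (vQ : (thetaIndex (pilotDataOfK T.D T.K)).VQ),
        Set ((logShellsDH (pilotDataOfK T.D T.K) (analyticLogv T.K)).Packet j vQ))
      (archSub : ∀ (j : (thetaIndex (pilotDataOfK T.D T.K)).Label) (v : (thetaIndex (pilotDataOfK T.D T.K)).V),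
        Set ((logShellsDH (pilotDataOfK T.D T.K) (analyticLogv T.K)).Packet j ((thetaIndex (pilotDataOfK T.D T.K)).over v)))
      (Ψ : ℤ → ∀ v : (thetaIndex (pilotDataOfK T.D T.K)).V, v ∈ (thetaIndex (pilotDataOfK T.D T.K)).Vbad →
        Set ((logShellsDH (pilotDataOfK T.D T.K) (analyticLogv T.K)).StarPacket v))
      (act : ℤ → ∀ v : (thetaIndex (pilotDataOfK T.D T.K)).V, v ∈ (thetaIndex (pilotDataOfK T.D T.K)).Vbad →
        (logShellsDH (pilotDataOfK T.D T.K) (analyticLogv T.K)).StarPacket v →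
          Module.End ℚ ((logShellsDH (pilotDataOfK T.D T.K) (analyticLogv T.K)).StarPacket v))
      (Mmod : ℤ → ∀ j : (thetaIndex (pilotDataOfK T.D T.K)).LabelStar,
        Set ((logShellsDH (pilotDataOfK T.D T.K) (analyticLogv T.K)).GlobalPacket j.1))
      (region : ℤ → ∀ j : (thetaIndex (pilotDataOfK T.D T.K)).LabelStar, FinDivisor M →
        ∀ vQ : (thetaIndex (pilotDataOfK T.D T.K)).VQ, Set ((logShellsDH (pilotDataOfK T.D T.K) (analyticLogv T.K)).Packet j.1 vQ))
      (n : ℤ) {HT : Type} {LogLink : HT → HT → Type} {IsFull : ∀ {s t : HT}, LogLink s t → Prop}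
      (lat : LGPGaussianLogThetaLattice LogLink IsFull)
      {Frd : Type} {IsoF : Frd → Frd → Type} {Ob : Frd → Type} {realify : Frd → Frd} {Strip : Type}
      {IsoS : Strip → Strip → Type}
      {Mv : ∀ v : (thetaIndex (pilotDataOfK T.D T.K)).V, v ∈ (thetaIndex (pilotDataOfK T.D T.K)).Vbad → Type}
      [∀ v h, Monoid (Mv v h)]
      (sig : GlobalLGPFrobenioidSignature (thetaIndex (pilotDataOfK T.D T.K)).lstar (thetaIndex (pilotDataOfK T.D T.K)).V
        (· ∈ (thetaIndex (pilotDataOfK T.D T.K)).Vbad) Frd IsoF Ob realify Strip IsoS Mv)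
      (split : SplittingMonoids Mv) {ObΔ : Type}
      {N : ∀ v : (thetaIndex (pilotDataOfK T.D T.K)).V, v ∈ (thetaIndex (pilotDataOfK T.D T.K)).Vbad → Type} [∀ v h, Monoid (N v h)]
      (qData : QPilotData ObΔ N)
      (σ : Set (Fin (thetaIndex (pilotDataOfK T.D T.K)).lstar × (thetaIndex (pilotDataOfK T.D T.K)).VQ)) (φ : Fin (thetaIndex (pilotDataOfK T.D T.K)).lstar × (thetaIndex (pilotDataOfK T.D T.K)).VQ → ℝ),
      (∀ c, 0 ≤ φ c) → (∀ c, σ.indicator (fun _ => (1 : ℝ)) c + φ c ≤ 1) →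
      (∀ vQ, ∑ i : Fin (thetaIndex (pilotDataOfK T.D T.K)).lstar, φ (i, vQ) *
            cellTrivialCost
              (settingPrVolSharp (pilotDataOfK T.D T.K) (logvAnalytic_analyticLogv (F := T.K)) M archPk archSub Ψ act Mmod region n lat
            sig split qData (exists_realising_qIdeles_pilotDataOfK T.D).choose (exists_realising_thetaIdeles_pilotDataOfK T.D).choose
            (exists_realising_qIdeles_pilotDataOfK T.D).choose_spec.1 (exists_realising_qIdeles_pilotDataOfK T.D).choose_spec.2.1) (i, vQ) ≤
          ∑ i : Fin (thetaIndex (pilotDataOfK T.D T.K)).lstar,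
            -σ.indicator (fun c : Fin (thetaIndex (pilotDataOfK T.D T.K)).lstar × (thetaIndex (pilotDataOfK T.D T.K)).VQ =>
              cellDeficit
                (settingPrVolSharp (pilotDataOfK T.D T.K) (logvAnalytic_analyticLogv (F := T.K)) M archPk archSub Ψ act Mmod region n lat
            sig split qData (exists_realising_qIdeles_pilotDataOfK T.D).choose (exists_realising_thetaIdeles_pilotDataOfK T.D).choose
            (exists_realising_qIdeles_pilotDataOfK T.D).choose_spec.1 (exists_realising_qIdeles_pilotDataOfK T.D).choose_spec.2.1) c.1 c.2) (i, vQ)) →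
      T.negAbsLogQ ≤ T.negLogTheta +
        (offTrivialMass
            (settingPrVolSharp (pilotDataOfK T.D T.K) (logvAnalytic_analyticLogv (F := T.K)) M archPk archSub Ψ act Mmod region n lat
            sig split qData (exists_realising_qIdeles_pilotDataOfK T.D).choose (exists_realising_thetaIdeles_pilotDataOfK T.D).choose
            (exists_realising_qIdeles_pilotDataOfK T.D).choose_spec.1 (exists_realising_qIdeles_pilotDataOfK T.D).choose_spec.2.1) σ -
          processionNormalized fun i : Fin (thetaIndex (pilotDataOfK T.D T.K)).lstar => ∑ᶠ vQ, φ (i, vQ) *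
            cellTrivialCost
              (settingPrVolSharp (pilotDataOfK T.D T.K) (logvAnalytic_analyticLogv (F := T.K)) M archPk archSub Ψ act Mmod region n lat
            sig split qData (exists_realising_qIdeles_pilotDataOfK T.D).choose (exists_realising_thetaIdeles_pilotDataOfK T.D).choose
            (exists_realising_qIdeles_pilotDataOfK T.D).choose_spec.1 (exists_realising_qIdeles_pilotDataOfK T.D).choose_spec.2.1) (i, vQ)) := by
  intro M _ _ archPk archSub Ψ act Mmod region n HT LogLink IsFull lat Frd IsoF Ob realify Strip IsoS Mv _ sig split ObΔ N _ qData σ φ hφ0 hφ1 hfin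
  letI := T.instFieldF; letI := T.instNumberFieldF; letI := T.instAlgebraF; letI := T.instFieldK
  letI := T.instNumberFieldK; letI := T.instAlgebraK; letI := T.instFieldFbar; letI := T.instAlgebraFbar
  letI := T.instAlgebraKFbar; letI := T.instIsElliptic
  have H := bridgeHyps_settingPrVolSharp_of_ideles (pilotDataOfK T.D T.K) (logvAnalytic_analyticLogv (F := T.K)) M archPk archSub Ψ act
    Mmod region n lat sig split qData (exists_realising_thetaIdeles_pilotDataOfK T.D).choose (exists_realising_qIdeles_pilotDataOfK T.D).choose
    (exists_realising_thetaIdeles_pilotDataOfK T.D).choose_spec.1 (exists_realising_thetaIdeles_pilotDataOfK T.D).choose_spec.2.1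
    (exists_realising_qIdeles_pilotDataOfK T.D).choose_spec.1 (exists_realising_qIdeles_pilotDataOfK T.D).choose_spec.2.1
  exact cor312UpTo_of_statementUpTo_chosen T M archPk archSub Ψ act Mmod region n lat sig split qData _
    (statementUpTo_withinFinanced H σ hφ0 hφ1 hfin)

/-! ## §3. (v2 append, abc-iut-topt-pv-3 2026-08-27) ACROSS ≤ WITHIN: the across-places tolerance of the prequel never exceeds the within-place one, so the
kernel chain `D ≤ F_across(σ) ≤ F_within(σ, φ) ≤ B_triv(σᶜ)` of rh-lead g3's R29 grid (LIC row) is complete -/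

section GenericOrder

variable {ι : ThetaIndex} {S : Situation ι} {P : Cor312.Setting S}

/-- **The signed on-σ charge pays for every within-place financing**: for EVERY stratum `σ` (no licence binder) and financing `φ ≥ 0` satisfying [FIN-within]
(each packet's financed trivial mass `≤` that packet's signed on-σ charge), `weightedDeficit P 1_σ + PN Σᶠ φ·t ≤ 0` — the TOTAL on-σ charge (`= −C_σ` under
the licence) absorbs the total financed mass (label sum and packet sum exchanged by `sum_finsum_comm`; packets net `≤ 0`). [claim: Mochizuki2012, status: disputed] -/
theorem weightedDeficit_indicator_add_financedMass_nonpos_of_packetFinanced (H : BridgeHyps P) (σ : Set (Fin ι.lstar × ι.VQ))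
    {φ : Fin ι.lstar × ι.VQ → ℝ}
    (hfin : ∀ vQ : ι.VQ, ∑ i : Fin ι.lstar, φ (i, vQ) * cellTrivialCost P (i, vQ) ≤
      ∑ i : Fin ι.lstar, -σ.indicator (fun c : Fin ι.lstar × ι.VQ => cellDeficit P c.1 c.2) (i, vQ)) :
    weightedDeficit P (σ.indicator fun _ => (1 : ℝ)) +
      processionNormalized (fun i : Fin ι.lstar => ∑ᶠ vQ : ι.VQ, φ (i, vQ) * cellTrivialCost P (i, vQ)) ≤ 0 := by
  set g : Fin ι.lstar → ι.VQ → ℝ := fun i vQ =>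
    σ.indicator (fun c : Fin ι.lstar × ι.VQ => cellDeficit P c.1 c.2) (i, vQ) + φ (i, vQ) * cellTrivialCost P (i, vQ) with hg
  have hgfin : ∀ i : Fin ι.lstar, (Function.support (g i)).Finite := fun i =>
    ((indicator_cellDeficit_support_finite H σ i).union (mul_cellTrivialCost_support_finite H φ i)).subset
      (Function.support_add _ _)
  -- the two PN-averages add up to the PN-average of `g`
  have hsum : weightedDeficit P (σ.indicator fun _ => (1 : ℝ)) +
      processionNormalized (fun i : Fin ι.lstar => ∑ᶠ vQ : ι.VQ, φ (i, vQ) * cellTrivialCost P (i, vQ)) =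
      (∑ i : Fin ι.lstar, ∑ᶠ vQ : ι.VQ, g i vQ) / ι.lstar := by
    rw [weightedDeficit_indicator]
    unfold processionNormalized
    rw [← add_div, ← Finset.sum_add_distrib]
    congr 1
    refine Finset.sum_congr rfl fun i _ => ?_
    rw [← finsum_add_distrib (indicator_cellDeficit_support_finite H σ i) (mul_cellTrivialCost_support_finite H φ i)]
  have hswap : ∑ i : Fin ι.lstar, ∑ᶠ vQ : ι.VQ, g i vQ = ∑ᶠ vQ : ι.VQ, ∑ i : Fin ι.lstar, g i vQ :=
    sum_finsum_comm Finset.univ g fun i _ => hgfin i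
  have hpacket : ∀ vQ : ι.VQ, ∑ i : Fin ι.lstar, g i vQ ≤ 0 := by
    intro vQ
    have h := hfin vQ
    rw [hg]
    simp only [Finset.sum_add_distrib]
    rw [Finset.sum_neg_distrib] at h
    linarith
  have hnonpos : ∑ᶠ vQ : ι.VQ, ∑ i : Fin ι.lstar, g i vQ ≤ 0 := by
    have h := finsum_nonneg (f := fun vQ : ι.VQ => -∑ i : Fin ι.lstar, g i vQ) fun vQ => neg_nonneg.mpr (hpacket vQ)
    rw [finsum_neg_distrib] at h
    exact neg_nonneg.mp h
  rw [hsum]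
  exact div_nonpos_iff.mpr (Or.inr ⟨hswap.le.trans hnonpos, Nat.cast_nonneg _⟩)

/-- **ACROSS ≤ WITHIN.** For every stratum `σ` and within-place financing `φ` satisfying [FIN-within]: the prequel's across-places financed slack
`F_across(σ) = weightedDeficit P 1_σ + offTrivialMass P σ` (p489258 `statementUpTo_onCharge_add_offTrivialMass`: the on-σ charge nets EVERYTHING in one
PN sum) is at most the within-place one `F_within(σ, φ) = offTrivialMass P σ − PN Σᶠ φ·t` (§1 `statementUpTo_withinFinanced`). With p489258
`signedRemainder_le_onCharge_add_offTrivialMass` and §1 `offTrivialMass_sub_financed_le_offTrivialMass` the LIC row of rh-lead g3's R29 grid is ordered in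
kernel: `D ≤ F_across ≤ F_within ≤ B_triv(σᶜ)` — the netting gain grows with the reach of the netting, and so does the cone charge (p491138). [claim: Mochizuki2012, status: disputed] -/
theorem onCharge_add_offTrivialMass_le_withinFinanced (H : BridgeHyps P) (σ : Set (Fin ι.lstar × ι.VQ))
    {φ : Fin ι.lstar × ι.VQ → ℝ}
    (hfin : ∀ vQ : ι.VQ, ∑ i : Fin ι.lstar, φ (i, vQ) * cellTrivialCost P (i, vQ) ≤
      ∑ i : Fin ι.lstar, -σ.indicator (fun c : Fin ι.lstar × ι.VQ => cellDeficit P c.1 c.2) (i, vQ)) :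
    weightedDeficit P (σ.indicator fun _ => (1 : ℝ)) + offTrivialMass P σ ≤
      offTrivialMass P σ - processionNormalized (fun i : Fin ι.lstar => ∑ᶠ vQ : ι.VQ, φ (i, vQ) * cellTrivialCost P (i, vQ)) := by
  linarith [weightedDeficit_indicator_add_financedMass_nonpos_of_packetFinanced H σ hfin]

end GenericOrder

end Summit.ABC.IUTFork.Conditional.SigmaMass

end
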